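import Literature.Computability.Complexity.IrreducibilityLLLBerlekampLoop
import HarnessLib

/-!
# Complete factorisation modulo `ℓ` on coefficient lists (LLL 1982, (3.1); Berlekamp)

Support file for the discharge of the named fact
`Literature.NumberTheory.NumberFields.nfIso_mem_P` (number-field isomorphism is in `P`;
Landau 1985, A. K. Lenstra 1983 Thm. (3.7)). The LLL degree test of `NFIsoDegreeTest.lean`
(`exists_irreducible_degree_le_iff`) ranges over the COMPLETE list of irreducible factors of
`F mod ℓ` — LLL82 (3.1): "we apply Berlekamp's algorithm … to find the complete factorization of
`(f mod p)`". The tree's `LLLFactoring.berlekampFactor` (`IrreducibilityLLLBerlekampLoop.lean`)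
extracts ONE monic irreducible factor of a squarefree monic polynomial over `𝔽_ℓ`; this file
iterates it, dividing out each factor found (`LLLFactoring.pdivmod`,
`IrreducibilityLLLPolyArith.lean`), as a total functional program on coefficient lists (normal
forms modulo `ℓ`, a fold over a unary budget of `|f|` steps), and proves its specification:

* `pdivM ℓ a b` — the quotient by a monic `b` modulo `ℓ`, in normal form (`toZMod_pdivM`);
* `lfStep`, `localFactors ℓ f` — repeatedly `u ← berlekampFactor ℓ W`, `W ← W / u`;
* **`localFactors_spec`** (`ℓ` prime, `f` normal with `f̄` monic squarefree of degree `|f| - 1`):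
  every `u ∈ localFactors ℓ f` is normal with `ū` monic irreducible of degree `|u| - 1`,
  `2 ≤ |u| ≤ |f|`; `∏ ū = f̄`; and there are at most `|f|` of them;
* `exists_mem_localFactors_dvd` — completeness in the form consumed by the degree test: every
  irreducible factor of `f̄` is divisible by some `ū`, `u ∈ localFactors ℓ f`.

## References

* A. K. Lenstra, H. W. Lenstra Jr., L. Lovász, *Factoring polynomials with rational coefficients*,
  Math. Ann. 261 (1982) 515–534, §3, (3.1) and proof of (3.6). [LenstraLenstraLovasz1982]
* D. E. Knuth, *The Art of Computer Programming*, Vol. 2, 3rd ed., 1998, §4.6.2, Algorithm B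
  (complete factorisation by repeated splitting). [KnuthTAOCP2]
* E. R. Berlekamp, *Factoring polynomials over finite fields*, Bell System Tech. J. 46 (1967)
  1853–1859.
-/

open Polynomial

namespace Literature.NumberTheory.NumberFields

open Literature.Computability.Complexity Literature.Computability.Complexity.LLLFactoring
open Literature.Computability.Complexity.SumcheckMA

/-! ### The program -/

/-- The quotient of `a` by the monic `b` modulo `ℓ`, in normal form.
[cite: KnuthTAOCP2, §4.6.1, Algorithm D] -/
def pdivM (ℓ : ℕ) (a b : List ℤ) : List ℤ := pnorm ℓ (pdivmod ℓ a b).1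

/-- One extraction step on the state `(W, acc)` (`W` the cofactor still to be factored, `acc`
the irreducible factors found so far): if `deg W̄ ≥ 1`, split off `u = berlekampFactor ℓ W` and
continue with `W / u`. [cite: KnuthTAOCP2, §4.6.2, Algorithm B] [cite: LenstraLenstraLovasz1982, (3.1)] -/
def lfStep (ℓ : ℕ) (st : List ℤ × List (List ℤ)) : List ℤ × List (List ℤ) :=
  if st.1.length < 2 then st
  else (pdivM ℓ st.1 (berlekampFactor ℓ st.1), berlekampFactor ℓ st.1 :: st.2)

/-- The run of `k` extraction steps from `(f, [])`. [cite: KnuthTAOCP2, §4.6.2, Algorithm B] -/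
def lfRun (ℓ : ℕ) (f : List ℤ) (k : ℕ) : List ℤ × List (List ℤ) :=
  (List.replicate k ()).foldl (fun st _ => lfStep ℓ st) (f, [])

/-- **The complete factorisation of `f mod ℓ`**: the list of monic irreducible factors collected
by `|f|` extraction steps. [cite: LenstraLenstraLovasz1982, (3.1) ("the complete factorization of f mod p")] [cite: KnuthTAOCP2, §4.6.2] -/
def localFactors (ℓ : ℕ) (f : List ℤ) : List (List ℤ) := (lfRun ℓ f f.length).2

/-- Unfolding of the run. [folklore] -/
theorem lfRun_succ (ℓ : ℕ) (f : List ℤ) (k : ℕ) : lfRun ℓ f (k + 1) = lfStep ℓ (lfRun ℓ f k) := by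
  rw [lfRun, List.replicate_succ', List.foldl_append, List.foldl_cons, List.foldl_nil, ← lfRun]

/-- The run starts at `(f, [])`. [folklore] -/
theorem lfRun_zero (ℓ : ℕ) (f : List ℤ) : lfRun ℓ f 0 = (f, []) := rfl

section Spec

variable {ℓ : ℕ} [hℓ : Fact ℓ.Prime]

/-! ### Division by a monic factor -/

/-- **The normal quotient**: for `b̄` monic of degree `|b| - 1` dividing `ā`, `pdivM ℓ a b` is a
normal list with `toZMod (pdivM ℓ a b) · b̄ = ā`. [cite: KnuthTAOCP2, §4.6.1, Algorithm D] -/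
theorem toZMod_pdivM {a b : List ℤ} (hb0 : b ≠ []) (hbm : (toZMod ℓ b).Monic)
    (hbd : (toZMod ℓ b).natDegree = b.length - 1) (hdvd : toZMod ℓ b ∣ toZMod ℓ a) :
    toZMod ℓ (pdivM ℓ a b) * toZMod ℓ b = toZMod ℓ a ∧ Normal ℓ (pdivM ℓ a b) := by
  have hp0 := hℓ.out.pos
  obtain ⟨hq, hr⟩ := toZMod_pdivmod hp0 (a := a) hb0 hbm hbd
  refine ⟨?_, normal_pnorm hp0 _⟩
  rw [pdivM, toZMod_pnorm, hq]
  have h1 := modByMonic_add_div (toZMod ℓ a) (toZMod ℓ b)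
  have h2 : toZMod ℓ a %ₘ toZMod ℓ b = 0 := (modByMonic_eq_zero_iff_dvd hbm).2 hdvd
  rw [h2, zero_add] at h1
  rw [mul_comm]
  exact h1

/-- A normal list whose polynomial is monic of degree `e` has length `e + 1`. [folklore] -/
theorem length_eq_of_normal_monic {a : List ℤ} (ha : Normal ℓ a) (hm : (toZMod ℓ a).Monic) :
    a.length = (toZMod ℓ a).natDegree + 1 := by
  have ha0 : a ≠ [] := fun h0 => by
    have := hm.ne_zero
    rw [h0, toZMod_nil] at this
    exact this rfl
  have h := (ha.natDegree_toZMod ha0).1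
  have := List.length_pos_of_ne_nil ha0
  omega

/-! ### The invariant of the extraction loop -/

/-- The invariant: `W` is normal with `W̄` monic of degree `|W| - 1`, `1 ≤ |W| ≤ |f|`,
`W̄ · ∏ acc = f̄`, every collected factor is normal, monic, irreducible of degree `|u| - 1` with
`2 ≤ |u| ≤ |f|`, and `|acc| + |W| ≤ |f| + 1`. [folklore] -/
def LFInv (ℓ : ℕ) (f : List ℤ) (st : List ℤ × List (List ℤ)) : Prop :=
  Normal ℓ st.1 ∧ (toZMod ℓ st.1).Monic ∧ (toZMod ℓ st.1).natDegree = st.1.length - 1 ∧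
    1 ≤ st.1.length ∧ st.1.length ≤ f.length ∧
    toZMod ℓ st.1 * (st.2.map (toZMod ℓ)).prod = toZMod ℓ f ∧
    (∀ u ∈ st.2, Normal ℓ u ∧ (toZMod ℓ u).Monic ∧ (toZMod ℓ u).natDegree = u.length - 1 ∧
      Irreducible (toZMod ℓ u) ∧ 2 ≤ u.length ∧ u.length ≤ f.length) ∧
    st.2.length + st.1.length ≤ f.length + 1

/-- **One extraction step** preserves the invariant; when `|W| ≥ 2` it shortens `W` and adds one
factor, otherwise it is idle. [cite: KnuthTAOCP2, §4.6.2, Algorithm B] -/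
theorem lfStep_spec {f : List ℤ} (hsqf : Squarefree (toZMod ℓ f)) {st : List ℤ × List (List ℤ)}
    (hst : LFInv ℓ f st) :
    LFInv ℓ f (lfStep ℓ st) ∧
      (2 ≤ st.1.length → (lfStep ℓ st).1.length + 1 ≤ st.1.length) ∧
      (st.1.length < 2 → lfStep ℓ st = st) := by
  obtain ⟨W, acc⟩ := st
  obtain ⟨hWn, hWm, hWd, hW1, hWf, hprod, hacc, hcount⟩ := hst
  dsimp only at hWn hWm hWd hW1 hWf hprod hcount ⊢
  by_cases hlt : W.length < 2
  · rw [lfStep, if_pos hlt]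
    exact ⟨⟨hWn, hWm, hWd, hW1, hWf, hprod, hacc, hcount⟩, fun h => by omega, fun _ => rfl⟩
  · rw [lfStep, if_neg hlt]
    have h2 : 2 ≤ W.length := by omega
    -- `W̄` is squarefree, as a divisor of `f̄`
    have hWdvd : toZMod ℓ W ∣ toZMod ℓ f := ⟨_, hprod.symm⟩
    have hsqW : Squarefree (toZMod ℓ W) := hsqf.squarefree_of_dvd hWdvd
    obtain ⟨hun, hum, hud, huirr, hudvd, hu2, hulen⟩ := berlekampFactor_spec hWn hWm hWd h2 hsqW
    set u := berlekampFactor ℓ W with hu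
    have hu0 : u ≠ [] := by rintro h0; rw [h0] at hu2; simp at hu2
    obtain ⟨hq, hqn⟩ := toZMod_pdivM (a := W) hu0 hum hud hudvd
    set q := pdivM ℓ W u with hqdef
    -- the quotient is monic of degree `deg W̄ - deg ū`
    have hqm : (toZMod ℓ q).Monic := Monic.of_mul_monic_right hum (by rw [hq]; exact hWm)
    have hqdeg : (toZMod ℓ q).natDegree + (toZMod ℓ u).natDegree = (toZMod ℓ W).natDegree := by
      rw [← hq, hqm.natDegree_mul hum]
    have hqlen : q.length = (toZMod ℓ q).natDegree + 1 := length_eq_of_normal_monic hqn hqm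
    have hqd' : (toZMod ℓ q).natDegree = q.length - 1 := by omega
    have hq1 : 1 ≤ q.length := by omega
    have hqW : q.length + 1 ≤ W.length := by omega
    have hqf : q.length ≤ f.length := by omega
    have hprod' : toZMod ℓ q * ((u :: acc).map (toZMod ℓ)).prod = toZMod ℓ f := by
      rw [List.map_cons, List.prod_cons, ← mul_assoc, hq, hprod]
    have hacc' : ∀ v ∈ u :: acc, Normal ℓ v ∧ (toZMod ℓ v).Monic ∧ (toZMod ℓ v).natDegree = v.length - 1 ∧
        Irreducible (toZMod ℓ v) ∧ 2 ≤ v.length ∧ v.length ≤ f.length := by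
      intro v hv
      rcases List.mem_cons.1 hv with rfl | hv
      · exact ⟨hun, hum, hud, huirr, hu2, hulen.trans hWf⟩
      · exact hacc v hv
    have hcount' : (u :: acc).length + q.length ≤ f.length + 1 := by
      rw [List.length_cons]
      omega
    exact ⟨⟨hqn, hqm, hqd', hq1, hqf, hprod', hacc', hcount'⟩, fun _ => hqW, fun h => absurd h hlt⟩

/-- **The run**: the invariant holds after every number of steps, and after `k` steps either
`|W| = 1` or `|W| + k ≤ |f|`. [cite: KnuthTAOCP2, §4.6.2, Algorithm B] -/
theorem lfRun_spec {f : List ℤ} (hfn : Normal ℓ f) (hfm : (toZMod ℓ f).Monic)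
    (hfd : (toZMod ℓ f).natDegree = f.length - 1) (hsqf : Squarefree (toZMod ℓ f)) :
    ∀ k : ℕ, LFInv ℓ f (lfRun ℓ f k) ∧ ((lfRun ℓ f k).1.length < 2 ∨ (lfRun ℓ f k).1.length + k ≤ f.length)
  | 0 => by
    have hf1 : 1 ≤ f.length := by
      have := length_eq_of_normal_monic hfn hfm
      omega
    rw [lfRun_zero]
    refine ⟨⟨hfn, hfm, hfd, hf1, le_rfl, by simp, fun u hu => absurd hu List.not_mem_nil, by simp⟩,
      Or.inr (by simp)⟩
  | k + 1 => by
    obtain ⟨hinv, hor⟩ := lfRun_spec hfn hfm hfd hsqf k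
    obtain ⟨hinv', hdec, hidle⟩ := lfStep_spec hsqf hinv
    rw [lfRun_succ]
    refine ⟨hinv', ?_⟩
    by_cases hlt : (lfRun ℓ f k).1.length < 2
    · left; rw [hidle hlt]; exact hlt
    · right
      have h1 := hdec (by omega)
      rcases hor with h | h
      · exact absurd h hlt
      · omega

/-- **Complete factorisation modulo `ℓ` is correct.** For `ℓ` prime and `f` a normal list whose
polynomial `f̄ ∈ 𝔽_ℓ[X]` is monic, squarefree, of degree `|f| - 1`: every `u ∈ localFactors ℓ f`
is normal with `ū` monic irreducible of degree `|u| - 1` and `2 ≤ |u| ≤ |f|`, the product of the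
`ū` is `f̄`, and at most `|f|` factors are listed. [cite: LenstraLenstraLovasz1982, (3.1)] [cite: KnuthTAOCP2, §4.6.2, Algorithm B] -/
theorem localFactors_spec {f : List ℤ} (hfn : Normal ℓ f) (hfm : (toZMod ℓ f).Monic)
    (hfd : (toZMod ℓ f).natDegree = f.length - 1) (hsqf : Squarefree (toZMod ℓ f)) :
    (∀ u ∈ localFactors ℓ f, Normal ℓ u ∧ (toZMod ℓ u).Monic ∧
        (toZMod ℓ u).natDegree = u.length - 1 ∧ Irreducible (toZMod ℓ u) ∧
        2 ≤ u.length ∧ u.length ≤ f.length) ∧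
      ((localFactors ℓ f).map (toZMod ℓ)).prod = toZMod ℓ f ∧
      (localFactors ℓ f).length ≤ f.length := by
  obtain ⟨⟨hWn, hWm, hWd, hW1, -, hprod, hacc, hcount⟩, hor⟩ := lfRun_spec hfn hfm hfd hsqf f.length
  have hrun : localFactors ℓ f = (lfRun ℓ f f.length).2 := rfl
  rw [hrun]
  -- at the end `|W| = 1`, so `W̄ = 1`
  have hW1' : (lfRun ℓ f f.length).1.length = 1 := by
    rcases hor with h | h
    · omega
    · omega
  have hWone : toZMod ℓ (lfRun ℓ f f.length).1 = 1 := by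
    have h0 : (toZMod ℓ (lfRun ℓ f f.length).1).natDegree = 0 := by rw [hWd, hW1']
    exact eq_one_of_monic_natDegree_zero hWm h0
  refine ⟨hacc, ?_, by omega⟩
  rw [hWone, one_mul] at hprod
  exact hprod

/-- **Completeness**: every irreducible factor `ρ` of `f̄` is divisible by `ū` for some listed `u`
(`ρ` is prime and divides `∏ ū = f̄`, so `ρ ∣ ū` for some `u`, and `ū` is irreducible).
[cite: LenstraLenstraLovasz1982, (3.1) and Prop. (2.5)] -/
theorem exists_mem_localFactors_dvd {f : List ℤ} (hfn : Normal ℓ f) (hfm : (toZMod ℓ f).Monic)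
    (hfd : (toZMod ℓ f).natDegree = f.length - 1) (hsqf : Squarefree (toZMod ℓ f))
    {ρ : (ZMod ℓ)[X]} (hρ : Irreducible ρ) (hρf : ρ ∣ toZMod ℓ f) :
    ∃ u ∈ localFactors ℓ f, toZMod ℓ u ∣ ρ := by
  obtain ⟨hacc, hprod, -⟩ := localFactors_spec hfn hfm hfd hsqf
  rw [← hprod] at hρf
  obtain ⟨x, hx, hρx⟩ := (Prime.dvd_prod_iff hρ.prime).1 hρf
  obtain ⟨u, hu, rfl⟩ := List.mem_map.1 hx
  obtain ⟨-, -, -, huirr, -, -⟩ := hacc u hu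
  exact ⟨u, hu, (hρ.associated_of_dvd huirr hρx).symm.dvd⟩

end Spec

end Literature.NumberTheory.NumberFields
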